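import Literature.MathematicalPhysics.QuantumFieldTheory.King1986.MinimizerAliasModes
import Literature.MathematicalPhysics.QuantumFieldTheory.King1986.AveragingWeightRateHolder
import Literature.MathematicalPhysics.QuantumFieldTheory.King1986.CompositionLaw
import Literature.MathematicalPhysics.QuantumFieldTheory.King1986.CovarianceRateTorus
import HarnessLib

/-!
# King 1986, Proposition 3.8 (3.71), MOMENTUM-SPACE CORE: the alias sums of the two-spacing difference of the
# minimiser kernel `a_kG_kQ_k^*` are `O(L^{−γk})` — (4.19)–(4.23) and the replacements (4.24), (4.29), (4.18), (4.31)
# ASSEMBLED, uniformly in the reduced momentum, the volume and the mass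

**Citation header (reproduction of PUBLISHED and PROVED work; seat `pub-ymgap-dag-n18-b` of the cell `pub-ymgap`,
Track-A node N18 = NE5 whose PRINTED MODEL of record is King's Prop. 3.8/3.9 — "the error is the same graph with a
difference of propagators on one line … Proposition 3.8 gives the desired factor L^{−γk}" (p. 665); companion of the
template modules `King1986/AveragingWeightRate(Holder)` (Lemma 4.4, (4.24)–(4.31) displays), `King1986/AliasSums`
((4.22)), `King1986/CompositionLaw` (Lemma 4.3), `King1986/EffectiveLaplacianRate` ((4.7)/(4.10)), whose headers list
«the ∫dp′ and the assembly of Proposition 3.8 (3.71)», «(4.19)–(4.21) themselves … the L^{−γk} extraction of (4.23)» as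
NOT COVERED — this file covers exactly that assembly, in momentum space).**
C. King, *The U(1) Higgs model. I. The continuum limit*, Commun. Math. Phys. **102** (1986) 649–677 [King1986], §3.4
Proposition 3.8 (3.71) p. 664 and §4 pp. 670–674: (4.1)–(4.5), (4.19)–(4.31).  Page images READ AS IMAGES by this seat:
`b2b-balaban-template/king-renders/1986-cmp102-king-u1-higgs-I-p016-x2.png` (p. 664: Prop. 3.8), `…-p017-x2.png` (p. 665),
`…-p022-x2.png` (p. 670: (4.1)–(4.6)), `…-p024-x2.png` (p. 672: (4.17)–(4.23)), `…-p025-x2.png` (p. 673: (4.24)–(4.31)),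
`…-p026-x2.png` (p. 674: "Therefore every term in (4.19) for m = 0 can be replaced, and so combining our bounds with
Theorem 3.3 we deduce (3.71).").  King's paper is TEMPLATE LITERATURE (a printed and proved `A = 0` mechanism, abelian
Higgs, `d = 2, 3`), not a manuscript under audit; nothing in this file is about Bałaban's papers or his covariant
objects.

**What King prints (verbatim).**  p. 664: «**Proposition 3.8.** For x′, y′ ∈ T_{η′}, 0 < α < 1, and γ sufficiently small,
|a_{k+n}G^{η′}_{k+n}Q^*_{k+n}(x′, z) − a_kG^η_kQ^*_k(x, z)|, … ≦ CL^{−γk} exp[−δ₀{|x − z|, dist({x, y}, z)}]. (3.71)»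
(with «When x′ ∈ T_{η′}, we denote by x that point in T_η for which x′ ∈ B^n(x).»).  p. 670: «(a_kG_kQ^*_k)(x, y) =
(2π)^{−d} ∫_{|p′|≦π} dp′ Δ^{(k)}(p′) Σ_l e^{i(p′+l)(x−y)} u^η_k(p′+l)/Δ^η(p′+l), (4.2) where x ∈ ηZ^d, y ∈ Z^d, p′ ∈ [−π, π),
l ∈ 2πZ^d and −π(L^k − 1) ≦ l_μ ≦ π(L^k − 1) for L odd», «u^η_k(p) = Π_{μ=1}^d [(e^{−ip_μ} − 1)η(e^{−iηp_μ} − 1)^{−1}], (4.3)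
Δ^η(p) = 4η^{−2} Σ_{μ=1}^d sin²(1/2ηp_μ) + m²(L^kε)², (4.4) Δ^{(k)}(p′) = (a_k^{−1} + Σ_l |u^η_k(p′+l)|²Δ^η(p′+l)^{−1})^{−1}. (4.5)».
p. 672: «where l ∈ 2πZ^d is the same as in (4.2). Also m ∈ 2πL^kZ^d and |m_μ| ≦ πL^k(L^n − 1) for L odd … The
corresponding expression for G^η_k is obtained from (4.19) by replacing x′, y′, η′ by x, y, η and (k+n) by (k), and
taking m = 0. We have the following bounds: |u^{η′}_{k+n}(p′+l+m)| < C Π_{μ=1}^d |p′_μ||(p′+l+m)_μ|^{−1}, (4.20)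
|Δ^{(k+n)}(p′)Δ^{η′}(p′+l+m)^{−1}| ≦ C|p′|²|p′+l+m|^{−2}. (4.21) … so the sum over l, m is bounded by
Σ_{l,m} |p′+l+m|^{α−1} Π_μ |(p′+l+m)_μ|^{−1} ≦ C for α < 1. (4.22) We first bound the terms in (4.19) with m ≠ 0 as follows:
|(4.19); m ≠ 0| ≦ … ≦ CL^{−γk} for α + γ < 1. (4.23) To analyze the m = 0 term in (4.19), we successively replace each
factor by the corresponding one in the expression for (∂_α(x, y)∂^η_μa_kG^η_kQ^*_k)(z) and bound the error. We must always
be careful to keep enough negative powers of momentum so that the sum over l is bounded.»  p. 673: «|exp[i(p′+l)x] −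
exp[i(p′+l)x′]| ≦ C|p′+l|^γ|x − x′|^γ ≦ CL^{−γk}|p′+l|^γ. (4.24) So keeping γ + α < 1, the error produced by the above
replacement is bounded by CL^{−γk}.» … «Lemma 4.4. |u^η_k(p′+l) − u^{η′}_{k+n}(p′+l)| ≦ CL^{−γk}|p′+l|^γ|u^η_k(p′+l)|. (4.29)»
… «Therefore we can replace u^{η′}_{k+n}(p′+l) by u^η_k(p′+l) and bound the error. Lemma 4.3 allows us to replace
Δ^{(k+n)}(p′) by Δ^{(k)}(p′). Finally, from (4.7) |Δ^{η′}(p′+l)^{−1} − Δ^η(p′+l)^{−1}| ≦ CL^{−2k} ≦ CL^{−γk}|p′+l|^{−2+γ}. (4.31)»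
p. 674: «Therefore every term in (4.19) for m = 0 can be replaced, and so combining our bounds with Theorem 3.3 we deduce
(3.71).»

**What this file PROVES (kernel; Mathlib + the named tree modules; NO `def … : Prop`, no named fact; first line of
(3.71) only — no Hölder derivative `∂_α`, no `∂^η_μ`).**  In King's momentum variables: reduced momentum
`p′ : Fin d → ℝ`, `|p′_μ| ≤ π`; aliases `q = p′ + 2πj` (`AliasSums.aliasPt`), coarse spacing `η = N⁻¹` (`N = L^k`), fine
spacing `η′ ≤ η` (`η′ = (RN)⁻¹`, `R = L^n`); a MODE of (4.2)/(4.19) is `modeTerm Δ η M q ξ = Δ·u^η(q)·Δ^η(q)⁻¹·e^{iq·ξ}`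
(`uWeight` of `AveragingWeightRate` = (4.3), `latticeSymbol` of `EffectiveLaplacianRate` = (4.4), `ξ` the position in
unit-lattice coordinates, `Δ` the value of the effective symbol (4.5) at `p′`, a free real parameter in §2–§6 and King's
`DeltaEff a_k L^k` of `CompositionLaw` in §7).
* §1 **(4.20)–(4.21) in kernel form**: `‖u^η(p′+2πk)‖ ≤ (π/2)^d·aliasWeight p′ k` (`norm_uWeight_alias_le`; per
  coordinate `|e^{−iq} − 1| = |e^{−ip′} − 1| ≤ |p′|` and `|D_η(q)| ≥ (2/π)|q|`), `Δ^η(q)⁻¹ ≤ (π²/4)‖q‖^{−2}` on the zone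
  (`inv_latticeSymbol_le`, Jordan; any mass `M ≥ 0`).
* §2 the modes and the **far aliases `m ≠ 0`** ((4.23)): `modeAmp_far_le` — an alias at sup-distance `≥ N` from the
  origin has `Δ·Δ^{η′}(q)⁻¹‖u^{η′}(q)‖ ≤ a(π/2)^d(π²/4)·N^{−γ}·aliasTerm (γ−1) p′ k` (the trade `‖q‖^{−2} ≤ N^{−γ}‖q‖^{γ−2}`);
  summed over any finite family of such aliases `≤ a(π/2)^d(π²/4)·aliasConst d (γ−1)·N^{−γ}` (`sum_modeAmp_far_le`,
  by `AliasSums.alias_sum_le_of_subset` = (4.22)).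
* §3 the real-variable trades of pp. 672–673 (`zone_trade`: `N^{−2} ≤ N^{−γ}π^{2−γ}‖q‖^{γ−2}` for `‖q‖ ≤ πN` = (4.31)'s
  second inequality), the phase bound **(4.24)** for the mode phases (`norm_modePhase_sub_le`, from
  `AveragingWeightRateHolder.norm_cexp_sub_cexp_le_rpow`), Lemma 4.4 at two spacings (`norm_uWeight_two_spacing_le` ⇐
  `lemma44_holder`), **(4.31)**'s first inequality at two spacings (`abs_inv_latticeSymbol_two_spacing_le` ⇐
  `latticeSymbol_inv_sub_ref_le` twice, constant `π²/24`), and the three-factor telescoping `norm_three_sub_le`.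
* §4 **the near aliases `l ≠ 0`, `m = 0`** (`norm_modeTerm_sub_near_le`): the four replacements Δ^{(k+n)} → Δ^{(k)}
  (hypothesis `|Δ_B − Δ_A| ≤ θN^{−2}Δ_A` = Lemma 4.3 in relative form), Δ^{η′} → Δ^η ((4.31)), u_{k+n} → u_k ((4.29)),
  x′ → x ((4.24)) give `‖T_B − T_A‖ ≤ (K₁N^{−γ} + K₂δ^γ)·aliasTerm (γ−1) p′ j` with EXPLICIT `K₁ = nearRateConst`,
  `K₂ = nearPosConst` (`δ` = the sup-distance of the two positions; King: `|x − x′| ≤ L^{−k}`).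
* §5 **the central alias `l = 0`** (`norm_modeTerm_sub_central_le`): the same with the input "(4.21) at `l = 0`",
  `Δ_A ≤ K·Δ^η(p′)`, in place of powers of `‖q‖` (constants `centralRateConst`, `centralPosConst`).
* §6 the digit bookkeeping of (4.19) (`zoneA_of_digit`, `zoneB_of_digits`, `far_of_digits` — the `m ≠ 0` aliases are at
  sup-distance `≥ πN ≥ N`; `combo_ne_zero`; injectivity of `(l, m) ↦ l + m` is `AliasSums.digits_injective_pi`) and the
  **ASSEMBLED BOUND** `alias_sums_two_spacing_le`:
  `Σ_{j∈J}Σ_{b∈B∖0}‖T_B(j+Nb)‖ + Σ_{j∈J}‖T_B(j) − T_A(j)‖ ≤ prop38RateConst·N^{−γ} + prop38PosConst·δ^γ` for digit sets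
  `2|j_μ| < N`, `2|b_μ| < R` (King's `|l_μ| ≤ π(L^k − 1)`, `|m_μ| ≤ πL^k(L^n − 1)`, `L` odd), `0 ≤ γ ≤ 1`, `d ≥ 1`, UNIFORMLY in
  `p′`, `M ≥ 0`, `R`.
* §7 King's own symbols meet the hypotheses: `DeltaEff_nonneg`, **`DeltaEff_le_mul_latticeSymbol`** ((4.21) at `l = 0`:
  `Δ^{(k)}(p′) ≤ (π²/4)^dΔ^η(p′)` from the `l = 0` term of (4.5) and `|u(p′)|² ≥ (4/π²)^d`, `B4Strip.Ur_zero_ge`),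
  **`lemma43_aK_rel`** (Lemma 4.3 in relative form at EVERY `p′` incl. `p′ = 0`, where the symbols are
  `(a_k⁻¹ + m⁻²)⁻¹`, `(a_{k+n}⁻¹ + m⁻²)⁻¹` and `a_{k+n}⁻¹ = a_k⁻¹ + L^{−2k}a_n⁻¹` — `CompositionLaw.lemma43_aK`,
  `CovarianceRateTorus.Torus.DeltaEff_zero`, `EffectiveLaplacianRate.inv_aK_add`), and the END
  **`king_prop38_aliasSums`**: for `a > 0`, `L ≥ 2`, `k, n ≥ 1`, `m² > 0`, `0 ≤ γ ≤ 1`, the alias sums of the difference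
  of the mode families of `a_{k+n}G_{k+n}Q^*_{k+n}` (at `x′`) and `a_kG_kQ^*_k` (at `x`, `|x′_μ − x_μ| ≤ δ`) are
  `≤ C₁(a, L, k∕n-free…)·L^{−γk} + C₂·δ^γ` with `C₁ = prop38RateConst a a (lemma43Const a L k n) (π²/4)^d d γ`,
  `C₂ = prop38PosConst a (π²/4)^d d γ` (the only `k, n`-dependence of `C₁` is through `a_k, a_n ∈ [a(1−L⁻²), a]`).

**How this is (3.71).**  By (4.2)/(4.19) the kernels are `(2π)^{−d}∫dp′ e^{−ip′z}·[mode sums]` (on a finite torus: the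
average over the finitely many reduced momenta), so the sup over `(x′, x, z)` of
`|a_{k+n}G_{k+n}Q^*_{k+n}(x′, z) − a_kG_kQ^*_k(x, z)|` is at most the bound of `king_prop38_aliasSums` at `δ = L^{−k}`, i.e.
`(C₁ + C₂)L^{−γk}`; the exponential factor of (3.71) is King's «combining our bounds with Theorem 3.3» (interpolation with
the uniform decay of both kernels), an input of [Ba 4] that this file does not touch.  The torus representation (4.2)
for the actual operators (`EffectiveLaplacianSymbol.minimiser`) and that interpolation are the announced sequels
(seat files F1/F3); here everything is a statement about explicit functions of the momenta.

**NOT COVERED.**  The Hölder-quotient and derivative lines of (3.71) ((4.26)–(4.28) enter there; their displays are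
kernel in `AveragingWeightRateHolder`); the representation (4.2)/(4.19) as an operator identity; the `p′`-integral;
Theorem 3.3; free boundary conditions / multiple reflections; even `L` (King's shifted `m`-lattice); `A ≠ 0`; anything
about Bałaban's covariant block averaging.  HONEST FRAMING: King's `A = 0` scalar MODEL of the two-spacing ("η-rate")
mechanism that the T⁴ programme's node NE5 postulates for Bałaban's one-step outputs — template literature, finite
lattice momenta, nothing continuum / mass-gap / Clay; count-neutral for the cell's 27 nodes.
-/

noncomputable section

open Real Finset

namespace Literature.MathematicalPhysics.QuantumFieldTheory.King1986

/-! ## §1 Real-variable bookkeeping: the `γ`-trades and replacement errors of pp. 672–673 -/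

/-- `(x²)⁻¹ = x^{−2}` as a real power (`x ≥ 0`). [folklore] -/
private theorem inv_sq_eq_rpow_neg_two {x : ℝ} (hx : 0 ≤ x) : (x ^ 2)⁻¹ = x ^ (-2 : ℝ) := by
  rw [Real.rpow_neg hx, show (2 : ℝ) = ((2 : ℕ) : ℝ) by norm_num, Real.rpow_natCast]

/-- Trade I, «CL^{−2k} ≦ CL^{−γk}»: `N^{−2} ≤ N^{−γ}` for `N ≥ 1`, `γ ≤ 2`. [folklore] -/
private theorem rpow_neg_two_le_rpow_neg {N γ : ℝ} (hN : 1 ≤ N) (hγ2 : γ ≤ 2) : N ^ (-2 : ℝ) ≤ N ^ (-γ) :=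
  Real.rpow_le_rpow_of_exponent_le hN (by linarith)

/-- Trade II: `‖q‖^{−2} ≤ ‖q‖^{γ−2}` for `‖q‖ ≥ 1`, `γ ≥ 0`. [folklore] -/
private theorem rpow_neg_two_le_rpow_sub {x γ : ℝ} (hx : 1 ≤ x) (hγ : 0 ≤ γ) : x ^ (-2 : ℝ) ≤ x ^ (γ - 1 - 1) :=
  Real.rpow_le_rpow_of_exponent_le hx (by linarith)

/-- Trade III (the zone trade of (4.31)): for `0 < x ≤ πN` and `γ ≤ 2`,
`N^{−2} ≤ N^{−γ} · π^{2−γ} · x^{γ−2}` — "`CL^{−2k} ≤ CL^{−γk}|p′+l|^{−2+γ}`". [cite: King1986, (4.31) p.673] -/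
theorem zone_trade {N x γ : ℝ} (hN : 0 < N) (hx : 0 < x) (hxN : x ≤ π * N) (hγ2 : γ ≤ 2) :
    N ^ (-2 : ℝ) ≤ N ^ (-γ) * (π ^ (2 - γ) * x ^ (γ - 1 - 1)) := by
  have hsplit : N ^ (-2 : ℝ) = N ^ (-γ) * N ^ (-(2 - γ)) := by
    rw [← Real.rpow_add hN]; congr 1; ring
  rw [hsplit]
  refine mul_le_mul_of_nonneg_left ?_ (Real.rpow_nonneg hN.le _)
  have hxpi : 0 < x / π := div_pos hx Real.pi_pos
  have hle : x / π ≤ N := by rw [div_le_iff₀ Real.pi_pos]; linarith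
  -- `N^{-(2-γ)} ≤ (x/π)^{-(2-γ)} = π^{2-γ} x^{γ-2}`
  have h1 : N ^ (-(2 - γ)) ≤ (x / π) ^ (-(2 - γ)) := by
    rw [Real.rpow_neg hN.le, Real.rpow_neg hxpi.le]
    exact inv_anti₀ (Real.rpow_pos_of_pos hxpi _) (Real.rpow_le_rpow hxpi.le hle (by linarith))
  have h2 : (x / π) ^ (-(2 - γ)) = π ^ (2 - γ) * x ^ (γ - 1 - 1) := by
    rw [Real.div_rpow hx.le Real.pi_pos.le, Real.rpow_neg Real.pi_pos.le, div_inv_eq_mul, mul_comm,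
      show (-(2 - γ)) = γ - 1 - 1 by ring]
  rw [← h2]; exact h1

/-- `Σ_μ |q_μ| ≤ d·‖q‖` (sup norm). [folklore] -/
private theorem sum_abs_le_card_mul_norm {d : ℕ} (q : Fin d → ℝ) : ∑ μ, |q μ| ≤ d * ‖q‖ := by
  have h : ∀ μ ∈ (Finset.univ : Finset (Fin d)), |q μ| ≤ ‖q‖ := fun μ _ => by
    rw [← Real.norm_eq_abs]; exact norm_le_pi_norm q μ
  calc ∑ μ, |q μ| ≤ ∑ _μ : Fin d, ‖q‖ := Finset.sum_le_sum h
    _ = d * ‖q‖ := by rw [Finset.sum_const, Finset.card_univ, Fintype.card_fin, nsmul_eq_mul]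

/-- The phase increment between two positions: `|q·ξ′ − q·ξ| ≤ d‖q‖δ` when `|ξ′_μ − ξ_μ| ≤ δ`. [folklore] -/
private theorem abs_phase_sub_le {d : ℕ} (q : Fin d → ℝ) {ξ ξ' : Fin d → ℝ} {δ : ℝ} (hδ : 0 ≤ δ)
    (hξ : ∀ μ, |ξ' μ - ξ μ| ≤ δ) :
    |∑ μ, q μ * ξ' μ - ∑ μ, q μ * ξ μ| ≤ d * ‖q‖ * δ := by
  rw [← Finset.sum_sub_distrib]
  calc |∑ μ, (q μ * ξ' μ - q μ * ξ μ)| ≤ ∑ μ, |q μ * ξ' μ - q μ * ξ μ| := Finset.abs_sum_le_sum_abs _ _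
    _ = ∑ μ, |q μ| * |ξ' μ - ξ μ| := by
        refine Finset.sum_congr rfl fun μ _ => ?_
        rw [← mul_sub, abs_mul]
    _ ≤ ∑ μ, |q μ| * δ := Finset.sum_le_sum fun μ _ => mul_le_mul_of_nonneg_left (hξ μ) (abs_nonneg _)
    _ = (∑ μ, |q μ|) * δ := by rw [Finset.sum_mul]
    _ ≤ d * ‖q‖ * δ := mul_le_mul_of_nonneg_right (sum_abs_le_card_mul_norm q) hδ

/-- **(4.24)** for the mode phases: `‖e^{iq·ξ′} − e^{iq·ξ}‖ ≤ 2·(d‖q‖δ)^γ` for `0 ≤ γ ≤ 1`, `|ξ′_μ − ξ_μ| ≤ δ`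
(King: `|exp[i(p′+l)x] − exp[i(p′+l)x′]| ≤ C|p′+l|^γ|x − x′|^γ`). [cite: King1986, (4.24) p.673] -/
theorem norm_modePhase_sub_le {d : ℕ} (q : Fin d → ℝ) {ξ ξ' : Fin d → ℝ} {δ γ : ℝ} (hδ : 0 ≤ δ)
    (hγ0 : 0 ≤ γ) (hγ1 : γ ≤ 1) (hξ : ∀ μ, |ξ' μ - ξ μ| ≤ δ) :
    ‖modePhase q ξ' - modePhase q ξ‖ ≤ 2 * ((d : ℝ) * ‖q‖ * δ) ^ γ := by
  unfold modePhase
  have h := norm_cexp_sub_cexp_le_rpow (∑ μ, q μ * ξ' μ) (∑ μ, q μ * ξ μ) hγ0 hγ1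
  refine h.trans ?_
  gcongr
  exact abs_phase_sub_le q hδ hξ

/-- The three-factor telescoping behind "replace each factor by the corresponding one … and bound the error":
`‖c_B u_B e_B − c_A u_A e_A‖ ≤ |c_B − c_A|‖u_B‖ + |c_A|‖u_B − u_A‖ + |c_A|‖u_A‖‖e_B − e_A‖` for unit phases.
[cite: King1986, p.672 ("we successively replace each factor")] -/
theorem norm_three_sub_le (cA cB : ℝ) (uA uB eA eB : ℂ) (heB : ‖eB‖ = 1) :
    ‖(cB : ℂ) * uB * eB - (cA : ℂ) * uA * eA‖
      ≤ |cB - cA| * ‖uB‖ + |cA| * ‖uB - uA‖ + |cA| * ‖uA‖ * ‖eB - eA‖ := by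
  have hid : (cB : ℂ) * uB * eB - (cA : ℂ) * uA * eA
      = ((cB : ℂ) - cA) * uB * eB + (cA : ℂ) * (uB - uA) * eB + (cA : ℂ) * uA * (eB - eA) := by ring
  rw [hid]
  refine (norm_add₃_le).trans ?_
  rw [norm_mul, norm_mul, heB, mul_one, ← Complex.ofReal_sub, Complex.norm_real, Real.norm_eq_abs,
    norm_mul, norm_mul, heB, mul_one, Complex.norm_real, Real.norm_eq_abs,
    norm_mul, norm_mul, Complex.norm_real, Real.norm_eq_abs]

/-- Zone bookkeeping: `|q_μ| ≤ πN` for all `μ` gives `‖q‖ ≤ πN` and, for `0 < η′ ≤ N⁻¹`, `|η′q_μ| ≤ π`. [folklore] -/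
private theorem zone_of_le {d : ℕ} {N : ℝ} (hN : 0 < N) {η' : ℝ} (hη' : 0 < η') (hη'N : η' ≤ N⁻¹)
    {q : Fin d → ℝ} (hz : ∀ μ, |q μ| ≤ π * N) (μ : Fin d) : |η' * q μ| ≤ π := by
  rw [abs_mul, abs_of_pos hη']
  calc η' * |q μ| ≤ N⁻¹ * |q μ| := mul_le_mul_of_nonneg_right hη'N (abs_nonneg _)
    _ ≤ π := by rw [inv_mul_le_iff₀ hN, mul_comm]; exact hz μ

/-- **Lemma 4.4 at two spacings `η′ ≤ η = N⁻¹`, alias form**: `‖u^{η′}(q) − u^{η}(q)‖ ≤ C₄₄·(N⁻¹·d‖q‖)^γ·‖u^η(q)‖`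
on the zone `|q_μ| ≤ πN`, `C₄₄ = (π/2)^{d+1} + 1` (from `lemma44_holder`). [cite: King1986, Lemma 4.4 (4.29) p.673] -/
theorem norm_uWeight_two_spacing_le {d : ℕ} {N : ℝ} (hN : 0 < N) {η' : ℝ} (hη' : 0 < η') (hη'N : η' ≤ N⁻¹)
    {γ : ℝ} (hγ0 : 0 ≤ γ) (hγ1 : γ ≤ 1) {q : Fin d → ℝ} (hz : ∀ μ, |q μ| ≤ π * N) :
    ‖uWeight η' q - uWeight N⁻¹ q‖
      ≤ ((π / 2) ^ (d + 1) + 1) * (N⁻¹ * (d * ‖q‖)) ^ γ * ‖uWeight N⁻¹ q‖ := by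
  have hη : 0 < N⁻¹ := inv_pos.mpr hN
  have hzA : ∀ μ, |N⁻¹ * q μ| ≤ π := fun μ => by
    rw [abs_mul, abs_of_pos hη, inv_mul_le_iff₀ hN, mul_comm]; exact hz μ
  have hzB : ∀ μ, |η' * q μ| ≤ π := fun μ => by
    rw [abs_mul, abs_of_pos hη']
    calc η' * |q μ| ≤ N⁻¹ * |q μ| := mul_le_mul_of_nonneg_right hη'N (abs_nonneg _)
      _ ≤ π := by rw [inv_mul_le_iff₀ hN, mul_comm]; exact hz μ
  have h := lemma44_holder hη hη' hγ0 hγ1 hzA hzB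
  rw [norm_sub_rev]
  refine h.trans (mul_le_mul_of_nonneg_right (mul_le_mul_of_nonneg_left ?_ (by positivity)) (norm_nonneg _))
  refine Real.rpow_le_rpow (by positivity) ?_ hγ0
  have hdiff : |N⁻¹ - η'| ≤ N⁻¹ := by
    rw [abs_of_nonneg (by linarith)]; linarith
  exact mul_le_mul hdiff (sum_abs_le_card_mul_norm q) (Finset.sum_nonneg fun μ _ => abs_nonneg _) hη.le

/-- **(4.31), two spacings against each other**: `|Δ^{η′}(q)⁻¹ − Δ^{η}(q)⁻¹| ≤ (π²/24)·N⁻²` for `η′ ≤ η = N⁻¹`,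
`q ≠ 0` in the zone — twice King's (4.7)/(4.10) `|Δ^η(p)⁻¹ − (|p|² + m²)⁻¹| ≤ Cη²` (`latticeSymbol_inv_sub_ref_le`).
[cite: King1986, (4.31) p.673] -/
theorem abs_inv_latticeSymbol_two_spacing_le {d : ℕ} {N : ℝ} (hN : 0 < N) {η' : ℝ} (hη' : 0 < η')
    (hη'N : η' ≤ N⁻¹) {M : ℝ} (hM : 0 ≤ M) {q : Fin d → ℝ} (hz : ∀ μ, |q μ| ≤ π * N) (hq0 : 0 < momSq q) :
    |(latticeSymbol η' M q)⁻¹ - (latticeSymbol N⁻¹ M q)⁻¹| ≤ π ^ 2 / 24 * (N ^ 2)⁻¹ := by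
  have hη : 0 < N⁻¹ := inv_pos.mpr hN
  have hzA : ∀ μ, |N⁻¹ * q μ| ≤ π := fun μ => by
    rw [abs_mul, abs_of_pos hη, inv_mul_le_iff₀ hN, mul_comm]; exact hz μ
  have hzB : ∀ μ, |η' * q μ| ≤ π := fun μ => by
    rw [abs_mul, abs_of_pos hη']
    calc η' * |q μ| ≤ N⁻¹ * |q μ| := mul_le_mul_of_nonneg_right hη'N (abs_nonneg _)
      _ ≤ π := by rw [inv_mul_le_iff₀ hN, mul_comm]; exact hz μ
  have h1 := latticeSymbol_inv_sub_ref_le (ne_of_gt hη') hM hzB hq0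
  have h2 := latticeSymbol_inv_sub_ref_le (ne_of_gt hη) hM hzA hq0
  have hη'2 : η' ^ 2 ≤ (N ^ 2)⁻¹ := by
    rw [← inv_pow]; exact pow_le_pow_left₀ hη'.le hη'N 2
  calc |(latticeSymbol η' M q)⁻¹ - (latticeSymbol N⁻¹ M q)⁻¹|
      ≤ |(latticeSymbol η' M q)⁻¹ - (momSq q + M)⁻¹| + |(momSq q + M)⁻¹ - (latticeSymbol N⁻¹ M q)⁻¹| :=
        abs_sub_le _ _ _
    _ ≤ π ^ 2 / 48 * η' ^ 2 + π ^ 2 / 48 * (N⁻¹) ^ 2 := by rw [abs_sub_comm] at h2; exact add_le_add h1 h2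
    _ ≤ π ^ 2 / 48 * (N ^ 2)⁻¹ + π ^ 2 / 48 * (N ^ 2)⁻¹ := by rw [inv_pow]; gcongr
    _ = π ^ 2 / 24 * (N ^ 2)⁻¹ := by ring

/-- (4.31) at two spacings WITHOUT the restriction `q ≠ 0` (at `q = 0` both symbols equal the mass term).
[cite: King1986, (4.31) p.673] -/
theorem abs_inv_latticeSymbol_two_spacing_le' {d : ℕ} {N : ℝ} (hN : 0 < N) {η' : ℝ} (hη' : 0 < η')
    (hη'N : η' ≤ N⁻¹) {M : ℝ} (hM : 0 ≤ M) {q : Fin d → ℝ} (hz : ∀ μ, |q μ| ≤ π * N) :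
    |(latticeSymbol η' M q)⁻¹ - (latticeSymbol N⁻¹ M q)⁻¹| ≤ π ^ 2 / 24 * (N ^ 2)⁻¹ := by
  rcases (momSq_nonneg q).eq_or_lt with h0 | hpos
  · -- `q = 0`
    have hq : ∀ μ, q μ = 0 := fun μ => by
      have h := (Finset.sum_eq_zero_iff_of_nonneg (fun ν _ => sq_nonneg (q ν))).mp h0.symm μ (Finset.mem_univ μ)
      exact pow_eq_zero_iff (n := 2) (by norm_num) |>.mp h
    have hls : ∀ η : ℝ, latticeSymbol η M q = M := fun η => by
      unfold latticeSymbol fdSymbol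
      simp [hq]
    rw [hls, hls, sub_self, abs_zero]
    positivity
  · exact abs_inv_latticeSymbol_two_spacing_le hN hη' hη'N hM hz hpos

/-! ## §2 The near aliases (`m = 0`, `l ≠ 0`): the four replacements (4.24), (4.29), (4.18), (4.31) -/

/-- **THE NEAR ALIASES, termwise** (King p.673: "every term in (4.19) for m = 0 can be replaced"): for a nonzero
alias `q = p′ + 2πj` in the zone `|q_μ| ≤ πN` of the coarse spacing `η = N⁻¹`, any finer spacing `0 < η′ ≤ η`,
effective symbols with `0 ≤ Δ_A ≤ a`, `|Δ_B − Δ_A| ≤ θN⁻²Δ_A` (Lemma 4.3), and positions `|ξ′_μ − ξ_μ| ≤ δ`: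
`‖Δ_B u^{η′}(q)Δ^{η′}(q)⁻¹e^{iq·ξ′} − Δ_A u^{η}(q)Δ^{η}(q)⁻¹e^{iq·ξ}‖ ≤ (K₁N^{−γ} + K₂δ^γ)·‖q‖^{γ−2}·aliasWeight`,
`0 ≤ γ ≤ 1`, with `K₁ = nearRateConst a θ d γ`, `K₂ = nearPosConst a d γ` — the replacements (4.18) [Δ^{(k+n)} →
Δ^{(k)}], (4.31) [Δ^{η′} → Δ^η], (4.29) [u_{k+n} → u_k], (4.24) [x′ → x], each traded to `L^{−γk}|p′+l|^{γ}`-form so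
that the alias sum (4.22) converges. [cite: King1986, (4.24)–(4.31) p.673] -/
theorem norm_modeTerm_sub_near_le {d : ℕ} {N : ℝ} (hN : 1 ≤ N) {η' : ℝ} (hη' : 0 < η') (hη'N : η' ≤ N⁻¹)
    {M : ℝ} (hM : 0 ≤ M) {γ : ℝ} (hγ0 : 0 ≤ γ) (hγ1 : γ ≤ 1)
    {ΔA ΔB aA θ : ℝ} (hΔA : 0 ≤ ΔA) (hΔAa : ΔA ≤ aA) (hθ : 0 ≤ θ)
    (h43 : |ΔB - ΔA| ≤ θ * (N ^ 2)⁻¹ * ΔA)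
    {p : Fin d → ℝ} (hp : ∀ μ, |p μ| ≤ π) {j : Fin d → ℤ} (hj : j ≠ 0)
    (hz : ∀ μ, |aliasPt p j μ| ≤ π * N)
    {ξ ξ' : Fin d → ℝ} {δ : ℝ} (hδ : 0 ≤ δ) (hξ : ∀ μ, |ξ' μ - ξ μ| ≤ δ) :
    ‖modeTerm ΔB η' M (aliasPt p j) ξ' - modeTerm ΔA N⁻¹ M (aliasPt p j) ξ‖
      ≤ (nearRateConst aA θ d γ * N ^ (-γ) + nearPosConst aA d γ * δ ^ γ) * aliasTerm (γ - 1) p j := by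
  -- names
  set q := aliasPt p j with hq_def
  set W := aliasWeight p j with hW_def
  set sA := (latticeSymbol N⁻¹ M q)⁻¹ with hsA_def
  set sB := (latticeSymbol η' M q)⁻¹ with hsB_def
  set uA := uWeight N⁻¹ q with huA_def
  set uB := uWeight η' q with huB_def
  set eA := modePhase q ξ with heA_def
  set eB := modePhase q ξ' with heB_def
  -- positivity bookkeeping
  have hNpos : 0 < N := lt_of_lt_of_le one_pos hN
  have hη : 0 < N⁻¹ := inv_pos.mpr hNpos
  have hq1 : 1 ≤ ‖q‖ := one_le_norm_aliasPt hp hj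
  have hqpos : 0 < ‖q‖ := lt_of_lt_of_le one_pos hq1
  have hqN : ‖q‖ ≤ π * N := (pi_norm_le_iff_of_nonneg (by positivity)).mpr fun μ => by
    rw [Real.norm_eq_abs]; exact hz μ
  have hzA : ∀ μ, |N⁻¹ * q μ| ≤ π := zone_of_le hNpos hη le_rfl hz
  have hzB : ∀ μ, |η' * q μ| ≤ π := zone_of_le hNpos hη' hη'N hz
  have haA : 0 ≤ aA := hΔA.trans hΔAa
  have hW0 : 0 ≤ W := aliasWeight_nonneg p j
  have hsA0 : 0 ≤ sA := inv_nonneg.mpr (latticeSymbol_nonneg _ hM q)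
  have hsB0 : 0 ≤ sB := inv_nonneg.mpr (latticeSymbol_nonneg _ hM q)
  -- the factor bounds
  have hsA : sA ≤ π ^ 2 / 4 * ‖q‖ ^ (-2 : ℝ) := inv_latticeSymbol_le (ne_of_gt hη) hM hzA hqpos
  have hsB : sB ≤ π ^ 2 / 4 * ‖q‖ ^ (-2 : ℝ) := inv_latticeSymbol_le (ne_of_gt hη') hM hzB hqpos
  have huA : ‖uA‖ ≤ (π / 2) ^ d * W := norm_uWeight_alias_le hη hp j hzA
  have huB : ‖uB‖ ≤ (π / 2) ^ d * W := norm_uWeight_alias_le hη' hp j hzB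
  have hdu : ‖uB - uA‖ ≤ ((π / 2) ^ (d + 1) + 1) * (N⁻¹ * (d * ‖q‖)) ^ γ * ‖uA‖ :=
    norm_uWeight_two_spacing_le hNpos hη' hη'N hγ0 hγ1 hz
  have hds : |sB - sA| ≤ π ^ 2 / 24 * (N ^ 2)⁻¹ :=
    abs_inv_latticeSymbol_two_spacing_le hNpos hη' hη'N hM hz
      (Torus.momSq_pos_of_ne_zero (norm_pos_iff.mp hqpos))
  have hde : ‖eB - eA‖ ≤ 2 * ((d : ℝ) * ‖q‖ * δ) ^ γ := norm_modePhase_sub_le q hδ hγ0 hγ1 hξ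
  have heB1 : ‖eB‖ = 1 := norm_modePhase q ξ'
  -- the trades
  have r1 : (N ^ 2)⁻¹ ≤ N ^ (-γ) := by
    rw [inv_sq_eq_rpow_neg_two hNpos.le]; exact rpow_neg_two_le_rpow_neg hN (by linarith)
  have r2 : ‖q‖ ^ (-2 : ℝ) ≤ ‖q‖ ^ (γ - 1 - 1) := rpow_neg_two_le_rpow_sub hq1 hγ0
  have r3 : (N ^ 2)⁻¹ ≤ N ^ (-γ) * (π ^ (2 - γ) * ‖q‖ ^ (γ - 1 - 1)) := by
    rw [inv_sq_eq_rpow_neg_two hNpos.le]; exact zone_trade hNpos hqpos hqN (by linarith)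
  have r4 : (N⁻¹ * (d * ‖q‖)) ^ γ = N ^ (-γ) * ((d : ℝ) ^ γ * ‖q‖ ^ γ) := by
    rw [Real.mul_rpow hη.le (by positivity), Real.inv_rpow hNpos.le, ← Real.rpow_neg hNpos.le,
      Real.mul_rpow (by positivity) (norm_nonneg _)]
  have r5 : ‖q‖ ^ (-2 : ℝ) * ‖q‖ ^ γ = ‖q‖ ^ (γ - 1 - 1) := by
    rw [← Real.rpow_add hqpos]; congr 1; ring
  have r6 : ((d : ℝ) * ‖q‖ * δ) ^ γ = (d : ℝ) ^ γ * ‖q‖ ^ γ * δ ^ γ := by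
    rw [Real.mul_rpow (by positivity) hδ, Real.mul_rpow (by positivity) (norm_nonneg _)]
  have hNγ : 0 ≤ N ^ (-γ) := Real.rpow_nonneg hNpos.le _
  have hqγ2 : 0 ≤ ‖q‖ ^ (γ - 1 - 1) := Real.rpow_nonneg hqpos.le _
  have hqγ : 0 ≤ ‖q‖ ^ γ := Real.rpow_nonneg hqpos.le _
  have hδγ : 0 ≤ δ ^ γ := Real.rpow_nonneg hδ _
  have hdγ : 0 ≤ (d : ℝ) ^ γ := Real.rpow_nonneg (by positivity) _
  -- the four terms
  have hT1 : |ΔB - ΔA| * sB * ‖uB‖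
      ≤ aA * (π / 2) ^ d * (π ^ 2 / 4 * θ) * (N ^ (-γ) * (‖q‖ ^ (γ - 1 - 1) * W)) := by
    calc |ΔB - ΔA| * sB * ‖uB‖
        ≤ (θ * (N ^ 2)⁻¹ * ΔA) * (π ^ 2 / 4 * ‖q‖ ^ (-2 : ℝ)) * ((π / 2) ^ d * W) := by gcongr
      _ ≤ (θ * N ^ (-γ) * aA) * (π ^ 2 / 4 * ‖q‖ ^ (γ - 1 - 1)) * ((π / 2) ^ d * W) := by gcongr
      _ = aA * (π / 2) ^ d * (π ^ 2 / 4 * θ) * (N ^ (-γ) * (‖q‖ ^ (γ - 1 - 1) * W)) := by ring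
  have hT2 : ΔA * |sB - sA| * ‖uB‖
      ≤ aA * (π / 2) ^ d * (π ^ 2 / 24 * π ^ (2 - γ)) * (N ^ (-γ) * (‖q‖ ^ (γ - 1 - 1) * W)) := by
    calc ΔA * |sB - sA| * ‖uB‖
        ≤ aA * (π ^ 2 / 24 * (N ^ 2)⁻¹) * ((π / 2) ^ d * W) := by gcongr
      _ ≤ aA * (π ^ 2 / 24 * (N ^ (-γ) * (π ^ (2 - γ) * ‖q‖ ^ (γ - 1 - 1)))) * ((π / 2) ^ d * W) := by
          gcongr
      _ = aA * (π / 2) ^ d * (π ^ 2 / 24 * π ^ (2 - γ)) * (N ^ (-γ) * (‖q‖ ^ (γ - 1 - 1) * W)) := by ring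
  have hT3 : ΔA * sA * ‖uB - uA‖
      ≤ aA * (π / 2) ^ d * (π ^ 2 / 4 * ((π / 2) ^ (d + 1) + 1) * (d : ℝ) ^ γ)
          * (N ^ (-γ) * (‖q‖ ^ (γ - 1 - 1) * W)) := by
    calc ΔA * sA * ‖uB - uA‖
        ≤ aA * (π ^ 2 / 4 * ‖q‖ ^ (-2 : ℝ))
            * (((π / 2) ^ (d + 1) + 1) * (N⁻¹ * (d * ‖q‖)) ^ γ * ((π / 2) ^ d * W)) := by
          gcongr
          exact hdu.trans (mul_le_mul_of_nonneg_left huA (by positivity))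
      _ = aA * (π / 2) ^ d * (π ^ 2 / 4 * ((π / 2) ^ (d + 1) + 1) * (d : ℝ) ^ γ)
            * (N ^ (-γ) * ((‖q‖ ^ (-2 : ℝ) * ‖q‖ ^ γ) * W)) := by rw [r4]; ring
      _ = _ := by rw [r5]
  have hT4 : ΔA * sA * ‖uA‖ * ‖eB - eA‖
      ≤ aA * (π / 2) ^ d * (π ^ 2 / 4) * 2 * (d : ℝ) ^ γ * (δ ^ γ * (‖q‖ ^ (γ - 1 - 1) * W)) := by
    calc ΔA * sA * ‖uA‖ * ‖eB - eA‖
        ≤ aA * (π ^ 2 / 4 * ‖q‖ ^ (-2 : ℝ)) * ((π / 2) ^ d * W) * (2 * ((d : ℝ) * ‖q‖ * δ) ^ γ) := by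
          gcongr
      _ = aA * (π / 2) ^ d * (π ^ 2 / 4) * 2 * (d : ℝ) ^ γ
            * (δ ^ γ * ((‖q‖ ^ (-2 : ℝ) * ‖q‖ ^ γ) * W)) := by rw [r6]; ring
      _ = _ := by rw [r5]
  -- the telescoping
  have hmain : ‖modeTerm ΔB η' M q ξ' - modeTerm ΔA N⁻¹ M q ξ‖
      ≤ |ΔB * sB - ΔA * sA| * ‖uB‖ + |ΔA * sA| * ‖uB - uA‖ + |ΔA * sA| * ‖uA‖ * ‖eB - eA‖ :=
    norm_three_sub_le (ΔA * sA) (ΔB * sB) uA uB eA eB heB1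
  have hc : |ΔB * sB - ΔA * sA| ≤ |ΔB - ΔA| * sB + ΔA * |sB - sA| := by
    have : ΔB * sB - ΔA * sA = (ΔB - ΔA) * sB + ΔA * (sB - sA) := by ring
    rw [this]
    refine (abs_add_le _ _).trans (le_of_eq ?_)
    rw [abs_mul, abs_mul, abs_of_nonneg hsB0, abs_of_nonneg hΔA]
  have hcA : |ΔA * sA| = ΔA * sA := abs_of_nonneg (mul_nonneg hΔA hsA0)
  rw [hcA] at hmain
  calc ‖modeTerm ΔB η' M q ξ' - modeTerm ΔA N⁻¹ M q ξ‖
      ≤ |ΔB * sB - ΔA * sA| * ‖uB‖ + ΔA * sA * ‖uB - uA‖ + ΔA * sA * ‖uA‖ * ‖eB - eA‖ := hmain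
    _ ≤ (|ΔB - ΔA| * sB + ΔA * |sB - sA|) * ‖uB‖ + ΔA * sA * ‖uB - uA‖
        + ΔA * sA * ‖uA‖ * ‖eB - eA‖ := by gcongr
    _ = |ΔB - ΔA| * sB * ‖uB‖ + ΔA * |sB - sA| * ‖uB‖ + ΔA * sA * ‖uB - uA‖
        + ΔA * sA * ‖uA‖ * ‖eB - eA‖ := by ring
    _ ≤ aA * (π / 2) ^ d * (π ^ 2 / 4 * θ) * (N ^ (-γ) * (‖q‖ ^ (γ - 1 - 1) * W))
        + aA * (π / 2) ^ d * (π ^ 2 / 24 * π ^ (2 - γ)) * (N ^ (-γ) * (‖q‖ ^ (γ - 1 - 1) * W))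
        + aA * (π / 2) ^ d * (π ^ 2 / 4 * ((π / 2) ^ (d + 1) + 1) * (d : ℝ) ^ γ)
          * (N ^ (-γ) * (‖q‖ ^ (γ - 1 - 1) * W))
        + aA * (π / 2) ^ d * (π ^ 2 / 4) * 2 * (d : ℝ) ^ γ * (δ ^ γ * (‖q‖ ^ (γ - 1 - 1) * W)) :=
        add_le_add (add_le_add (add_le_add hT1 hT2) hT3) hT4
    _ = (nearRateConst aA θ d γ * N ^ (-γ) + nearPosConst aA d γ * δ ^ γ) * aliasTerm (γ - 1) p j := by
        simp only [nearRateConst, nearPosConst, aliasTerm, hq_def, hW_def]; ring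

/-! ## §3 The central alias `l = 0` (the reduced momentum itself) -/

/-- The "(4.21) at `l = 0`" input in product form: if `Δ_A ≤ K·Δ^{η}(p)` (the effective symbol is dominated by the
lattice symbol at the central alias) then `Δ_A·Δ^{η′}(p)⁻¹ ≤ K·π²/4` for any finer spacing `η′` in the zone.
[cite: King1986, (4.21) p.672] -/
theorem central_ratio_le {d : ℕ} {η η' : ℝ} (hη : η ≠ 0) (hη' : η' ≠ 0) {M : ℝ} (hM : 0 ≤ M) {ΔA K : ℝ}
    (hK : 0 ≤ K) {p : Fin d → ℝ} (hzB : ∀ μ, |η' * p μ| ≤ π)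
    (hcen : ΔA ≤ K * latticeSymbol η M p) :
    ΔA * (latticeSymbol η' M p)⁻¹ ≤ K * (π ^ 2 / 4) := by
  have hlsB0 : 0 ≤ latticeSymbol η' M p := latticeSymbol_nonneg _ hM p
  rcases hlsB0.eq_or_lt with h0 | hpos
  · rw [← h0, inv_zero, mul_zero]; positivity
  · have hup : latticeSymbol η M p ≤ momSq p + M := latticeSymbol_le hη M p
    have hlow : 4 / π ^ 2 * momSq p + M ≤ latticeSymbol η' M p := latticeSymbol_ge_jordan hη' M hzB
    have hpi : 4 / π ^ 2 ≤ 1 := by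
      rw [div_le_one (by positivity)]; nlinarith [Real.pi_gt_three]
    have hlow' : 4 / π ^ 2 * (momSq p + M) ≤ latticeSymbol η' M p := by
      nlinarith [momSq_nonneg p]
    rw [← div_eq_mul_inv, div_le_iff₀ hpos]
    calc ΔA ≤ K * latticeSymbol η M p := hcen
      _ ≤ K * (momSq p + M) := mul_le_mul_of_nonneg_left hup hK
      _ ≤ K * (π ^ 2 / 4 * latticeSymbol η' M p) := by
          refine mul_le_mul_of_nonneg_left ?_ hK
          have : momSq p + M ≤ π ^ 2 / 4 * (4 / π ^ 2 * (momSq p + M)) := by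
            rw [← mul_assoc, show π ^ 2 / 4 * (4 / π ^ 2) = 1 by field_simp, one_mul]
          exact this.trans (mul_le_mul_of_nonneg_left hlow' (by positivity))
      _ = K * (π ^ 2 / 4) * latticeSymbol η' M p := by ring

/-- **THE CENTRAL ALIAS** `l = 0` (`q = p′`, `|p′_μ| ≤ π`): with the extra input `Δ_A ≤ K·Δ^η(p′)` (for King's
`Δ^{(k)}` this holds with `K = (π²/4)^d`, see `DeltaEff_le_mul_latticeSymbol`),
`‖Δ_B u^{η′}(p′)Δ^{η′}(p′)⁻¹e^{ip′·ξ′} − Δ_A u^{η}(p′)Δ^{η}(p′)⁻¹e^{ip′·ξ}‖ ≤ K_c1·N^{−γ} + K_c2·δ^γ`.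
[cite: King1986, (4.24)–(4.31) p.673] -/
theorem norm_modeTerm_sub_central_le {d : ℕ} {N : ℝ} (hN : 1 ≤ N) {η' : ℝ} (hη' : 0 < η') (hη'N : η' ≤ N⁻¹)
    {M : ℝ} (hM : 0 ≤ M) {γ : ℝ} (hγ0 : 0 ≤ γ) (hγ1 : γ ≤ 1)
    {ΔA ΔB aA θ K : ℝ} (hΔA : 0 ≤ ΔA) (hΔAa : ΔA ≤ aA) (hθ : 0 ≤ θ) (hK : 0 ≤ K)
    (h43 : |ΔB - ΔA| ≤ θ * (N ^ 2)⁻¹ * ΔA)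
    {p : Fin d → ℝ} (hp : ∀ μ, |p μ| ≤ π) (hcen : ΔA ≤ K * latticeSymbol N⁻¹ M p)
    {ξ ξ' : Fin d → ℝ} {δ : ℝ} (hδ : 0 ≤ δ) (hξ : ∀ μ, |ξ' μ - ξ μ| ≤ δ) :
    ‖modeTerm ΔB η' M p ξ' - modeTerm ΔA N⁻¹ M p ξ‖
      ≤ centralRateConst aA θ K d γ * N ^ (-γ) + centralPosConst K d γ * δ ^ γ := by
  set sA := (latticeSymbol N⁻¹ M p)⁻¹ with hsA_def
  set sB := (latticeSymbol η' M p)⁻¹ with hsB_def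
  set uA := uWeight N⁻¹ p with huA_def
  set uB := uWeight η' p with huB_def
  set eA := modePhase p ξ with heA_def
  set eB := modePhase p ξ' with heB_def
  have hNpos : 0 < N := lt_of_lt_of_le one_pos hN
  have hη : 0 < N⁻¹ := inv_pos.mpr hNpos
  have hz : ∀ μ, |p μ| ≤ π * N := fun μ => (hp μ).trans (by nlinarith [Real.pi_pos])
  have hzA : ∀ μ, |N⁻¹ * p μ| ≤ π := zone_of_le hNpos hη le_rfl hz
  have hzB : ∀ μ, |η' * p μ| ≤ π := zone_of_le hNpos hη' hη'N hz
  have hpN : ‖p‖ ≤ π := (pi_norm_le_iff_of_nonneg Real.pi_pos.le).mpr fun μ => by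
    rw [Real.norm_eq_abs]; exact hp μ
  have haA : 0 ≤ aA := hΔA.trans hΔAa
  have hsA0 : 0 ≤ sA := inv_nonneg.mpr (latticeSymbol_nonneg _ hM p)
  have hsB0 : 0 ≤ sB := inv_nonneg.mpr (latticeSymbol_nonneg _ hM p)
  -- factor bounds
  have hcA : ΔA * sA ≤ K * (π ^ 2 / 4) := central_ratio_le (ne_of_gt hη) (ne_of_gt hη) hM hK hzA hcen
  have hcA' : ΔA * sA ≤ K := by
    -- directly: `Δ_A ≤ K·Δ^η(p)`
    rcases (latticeSymbol_nonneg N⁻¹ hM p).eq_or_lt with h0 | hpos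
    · rw [hsA_def, ← h0, inv_zero, mul_zero]; exact hK
    · rw [hsA_def, ← div_eq_mul_inv, div_le_iff₀ hpos]; exact hcen
  have hcB : ΔA * sB ≤ K * (π ^ 2 / 4) := central_ratio_le (ne_of_gt hη) (ne_of_gt hη') hM hK hzB hcen
  have huA : ‖uA‖ ≤ (π / 2) ^ d := norm_uWeight_le hη hzA
  have huB : ‖uB‖ ≤ (π / 2) ^ d := norm_uWeight_le hη' hzB
  have hdu : ‖uB - uA‖ ≤ ((π / 2) ^ (d + 1) + 1) * (N⁻¹ * (d * ‖p‖)) ^ γ * ‖uA‖ :=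
    norm_uWeight_two_spacing_le hNpos hη' hη'N hγ0 hγ1 hz
  have hds : |sB - sA| ≤ π ^ 2 / 24 * (N ^ 2)⁻¹ :=
    abs_inv_latticeSymbol_two_spacing_le' hNpos hη' hη'N hM hz
  have hde : ‖eB - eA‖ ≤ 2 * ((d : ℝ) * ‖p‖ * δ) ^ γ := norm_modePhase_sub_le p hδ hγ0 hγ1 hξ
  have heB1 : ‖eB‖ = 1 := norm_modePhase p ξ'
  -- trades
  have r1 : (N ^ 2)⁻¹ ≤ N ^ (-γ) := by
    rw [inv_sq_eq_rpow_neg_two hNpos.le]; exact rpow_neg_two_le_rpow_neg hN (by linarith)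
  have r4 : (N⁻¹ * (d * ‖p‖)) ^ γ ≤ N ^ (-γ) * ((d : ℝ) * π) ^ γ := by
    rw [Real.mul_rpow hη.le (by positivity), Real.inv_rpow hNpos.le, ← Real.rpow_neg hNpos.le]
    exact mul_le_mul_of_nonneg_left (Real.rpow_le_rpow (by positivity) (by gcongr) hγ0)
      (Real.rpow_nonneg hNpos.le _)
  have r6 : ((d : ℝ) * ‖p‖ * δ) ^ γ ≤ ((d : ℝ) * π) ^ γ * δ ^ γ := by
    rw [Real.mul_rpow (by positivity) hδ]
    exact mul_le_mul_of_nonneg_right (Real.rpow_le_rpow (by positivity) (by gcongr) hγ0)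
      (Real.rpow_nonneg hδ _)
  have hNγ : 0 ≤ N ^ (-γ) := Real.rpow_nonneg hNpos.le _
  have hδγ : 0 ≤ δ ^ γ := Real.rpow_nonneg hδ _
  have hdπγ : 0 ≤ ((d : ℝ) * π) ^ γ := Real.rpow_nonneg (by positivity) _
  -- the four terms
  have hT1 : |ΔB - ΔA| * sB * ‖uB‖ ≤ (π / 2) ^ d * (θ * K * (π ^ 2 / 4)) * N ^ (-γ) := by
    calc |ΔB - ΔA| * sB * ‖uB‖ ≤ (θ * (N ^ 2)⁻¹ * ΔA) * sB * (π / 2) ^ d := by gcongr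
      _ = θ * (N ^ 2)⁻¹ * (ΔA * sB) * (π / 2) ^ d := by ring
      _ ≤ θ * N ^ (-γ) * (K * (π ^ 2 / 4)) * (π / 2) ^ d := by gcongr
      _ = (π / 2) ^ d * (θ * K * (π ^ 2 / 4)) * N ^ (-γ) := by ring
  have hT2 : ΔA * |sB - sA| * ‖uB‖ ≤ (π / 2) ^ d * (aA * (π ^ 2 / 24)) * N ^ (-γ) := by
    calc ΔA * |sB - sA| * ‖uB‖ ≤ aA * (π ^ 2 / 24 * (N ^ 2)⁻¹) * (π / 2) ^ d := by gcongr
      _ ≤ aA * (π ^ 2 / 24 * N ^ (-γ)) * (π / 2) ^ d := by gcongr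
      _ = (π / 2) ^ d * (aA * (π ^ 2 / 24)) * N ^ (-γ) := by ring
  have hT3 : ΔA * sA * ‖uB - uA‖
      ≤ (π / 2) ^ d * (K * (π ^ 2 / 4) * ((π / 2) ^ (d + 1) + 1) * ((d : ℝ) * π) ^ γ) * N ^ (-γ) := by
    calc ΔA * sA * ‖uB - uA‖
        ≤ (K * (π ^ 2 / 4)) * (((π / 2) ^ (d + 1) + 1) * (N ^ (-γ) * ((d : ℝ) * π) ^ γ) * (π / 2) ^ d) := by
          refine mul_le_mul hcA (hdu.trans ?_) (norm_nonneg _) (by positivity)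
          gcongr
      _ = (π / 2) ^ d * (K * (π ^ 2 / 4) * ((π / 2) ^ (d + 1) + 1) * ((d : ℝ) * π) ^ γ) * N ^ (-γ) := by
          ring
  have hT4 : ΔA * sA * ‖uA‖ * ‖eB - eA‖ ≤ 2 * K * (π / 2) ^ d * ((d : ℝ) * π) ^ γ * δ ^ γ := by
    calc ΔA * sA * ‖uA‖ * ‖eB - eA‖ ≤ K * (π / 2) ^ d * (2 * (((d : ℝ) * π) ^ γ * δ ^ γ)) := by
          refine mul_le_mul (mul_le_mul hcA' huA (norm_nonneg _) hK) (hde.trans ?_) (norm_nonneg _)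
            (by positivity)
          gcongr
      _ = 2 * K * (π / 2) ^ d * ((d : ℝ) * π) ^ γ * δ ^ γ := by ring
  -- telescoping
  have hmain : ‖modeTerm ΔB η' M p ξ' - modeTerm ΔA N⁻¹ M p ξ‖
      ≤ |ΔB * sB - ΔA * sA| * ‖uB‖ + |ΔA * sA| * ‖uB - uA‖ + |ΔA * sA| * ‖uA‖ * ‖eB - eA‖ :=
    norm_three_sub_le (ΔA * sA) (ΔB * sB) uA uB eA eB heB1
  have hc : |ΔB * sB - ΔA * sA| ≤ |ΔB - ΔA| * sB + ΔA * |sB - sA| := by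
    have : ΔB * sB - ΔA * sA = (ΔB - ΔA) * sB + ΔA * (sB - sA) := by ring
    rw [this]
    refine (abs_add_le _ _).trans (le_of_eq ?_)
    rw [abs_mul, abs_mul, abs_of_nonneg hsB0, abs_of_nonneg hΔA]
  have hcA0 : |ΔA * sA| = ΔA * sA := abs_of_nonneg (mul_nonneg hΔA hsA0)
  rw [hcA0] at hmain
  calc ‖modeTerm ΔB η' M p ξ' - modeTerm ΔA N⁻¹ M p ξ‖
      ≤ |ΔB * sB - ΔA * sA| * ‖uB‖ + ΔA * sA * ‖uB - uA‖ + ΔA * sA * ‖uA‖ * ‖eB - eA‖ := hmain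
    _ ≤ (|ΔB - ΔA| * sB + ΔA * |sB - sA|) * ‖uB‖ + ΔA * sA * ‖uB - uA‖
        + ΔA * sA * ‖uA‖ * ‖eB - eA‖ := by gcongr
    _ = |ΔB - ΔA| * sB * ‖uB‖ + ΔA * |sB - sA| * ‖uB‖ + ΔA * sA * ‖uB - uA‖
        + ΔA * sA * ‖uA‖ * ‖eB - eA‖ := by ring
    _ ≤ (π / 2) ^ d * (θ * K * (π ^ 2 / 4)) * N ^ (-γ) + (π / 2) ^ d * (aA * (π ^ 2 / 24)) * N ^ (-γ)
        + (π / 2) ^ d * (K * (π ^ 2 / 4) * ((π / 2) ^ (d + 1) + 1) * ((d : ℝ) * π) ^ γ) * N ^ (-γ)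
        + 2 * K * (π / 2) ^ d * ((d : ℝ) * π) ^ γ * δ ^ γ :=
        add_le_add (add_le_add (add_le_add hT1 hT2) hT3) hT4
    _ = centralRateConst aA θ K d γ * N ^ (-γ) + centralPosConst K d γ * δ ^ γ := by
        simp only [centralRateConst, centralPosConst]; ring

/-! ## §4 The digit bookkeeping of (4.19) (`l ∈ 2πℤ^d`, `m ∈ 2πL^kℤ^d`) and the assembled bound -/

/-- The central alias point is the reduced momentum itself. [folklore] -/
private theorem aliasPt_zero {d : ℕ} (p : Fin d → ℝ) : aliasPt p 0 = p := by
  funext μ; simp [aliasPt]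

/-- A digit `j` with `2|j_μ| < N` (King: `|l_μ| ≤ π(L^k − 1)`, `L` odd) satisfies `2|j_μ| + 1 ≤ N` over `ℝ`. [folklore] -/
private theorem two_abs_add_one_le {N : ℕ} {a : ℤ} (ha : 2 * |a| < (N : ℤ)) : 2 * |(a : ℝ)| + 1 ≤ N := by
  have h : 2 * |a| + 1 ≤ (N : ℤ) := ha
  have h' : ((2 * |a| + 1 : ℤ) : ℝ) ≤ ((N : ℤ) : ℝ) := by exact_mod_cast h
  push_cast at h'
  simpa [Int.cast_abs] using h'

/-- ZONE OF THE COARSE RUN: the aliases `p′ + 2πj`, `2|j_μ| < N`, lie in `|q_μ| ≤ πN` (`= π/η`).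
[cite: King1986, (4.2) p.670] -/
theorem zoneA_of_digit {d : ℕ} {N : ℕ} {p : Fin d → ℝ} (hp : ∀ μ, |p μ| ≤ π) {j : Fin d → ℤ}
    (hj : ∀ μ, 2 * |j μ| < (N : ℤ)) (μ : Fin d) : |aliasPt p j μ| ≤ π * N := by
  have h1 := two_abs_add_one_le (hj μ)
  simp only [aliasPt]
  calc |p μ + 2 * π * (j μ : ℝ)| ≤ |p μ| + |2 * π * (j μ : ℝ)| := abs_add_le _ _
    _ ≤ π + 2 * π * |(j μ : ℝ)| := by
        rw [abs_mul, abs_of_pos (by positivity : (0:ℝ) < 2 * π)]; linarith [hp μ]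
    _ = π * (2 * |(j μ : ℝ)| + 1) := by ring
    _ ≤ π * N := mul_le_mul_of_nonneg_left h1 Real.pi_pos.le

/-- ZONE OF THE FINE RUN: the aliases `p′ + 2π(j + Nb)`, `2|j_μ| < N`, `2|b_μ| < R`, lie in `|q_μ| ≤ πRN` (`= π/η′`).
[cite: King1986, (4.19) p.672] -/
theorem zoneB_of_digits {d : ℕ} {N R : ℕ} {p : Fin d → ℝ} (hp : ∀ μ, |p μ| ≤ π) {j b : Fin d → ℤ}
    (hj : ∀ μ, 2 * |j μ| < (N : ℤ)) (hb : ∀ μ, 2 * |b μ| < (R : ℤ)) (μ : Fin d) :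
    |aliasPt p (j + (N : ℤ) • b) μ| ≤ π * ((R : ℝ) * N) := by
  have h1 := two_abs_add_one_le (hj μ)
  have h2 := two_abs_add_one_le (hb μ)
  have hN0 : (0 : ℝ) ≤ N := Nat.cast_nonneg N
  simp only [aliasPt, Pi.add_apply, Pi.smul_apply, smul_eq_mul, Int.cast_add, Int.cast_mul, Int.cast_natCast]
  calc |p μ + 2 * π * ((j μ : ℝ) + (N : ℝ) * (b μ : ℝ))|
      ≤ |p μ| + |2 * π * ((j μ : ℝ) + (N : ℝ) * (b μ : ℝ))| := abs_add_le _ _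
    _ ≤ π + 2 * π * (|(j μ : ℝ)| + (N : ℝ) * |(b μ : ℝ)|) := by
        refine add_le_add (hp μ) ?_
        rw [abs_mul, abs_of_pos (by positivity : (0:ℝ) < 2 * π)]
        refine mul_le_mul_of_nonneg_left ((abs_add_le _ _).trans ?_) (by positivity)
        rw [abs_mul, abs_of_nonneg hN0]
    _ ≤ π * ((R : ℝ) * N) := by
        have e1 : 2 * π * |(j μ : ℝ)| ≤ π * ((N : ℝ) - 1) := by nlinarith [Real.pi_pos]
        have e2 : 2 * π * ((N : ℝ) * |(b μ : ℝ)|) ≤ π * (N : ℝ) * ((R : ℝ) - 1) := by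
          have h3 : 2 * |(b μ : ℝ)| ≤ (R : ℝ) - 1 := by linarith
          have := mul_le_mul_of_nonneg_left h3 (by positivity : (0:ℝ) ≤ π * N)
          nlinarith
        nlinarith [Real.pi_pos]

/-- THE `m ≠ 0` ALIASES ARE FAR: for `b ≠ 0`, `‖p′ + 2π(j + Nb)‖ ≥ N` (indeed `≥ πN`: the coordinate carrying
`b_μ ≠ 0` is `≥ 2πN|b_μ| − |p′_μ + 2πj_μ| ≥ πN`). [cite: King1986, (4.23) p.672] -/
theorem far_of_digits {d : ℕ} {N : ℕ} {p : Fin d → ℝ} (hp : ∀ μ, |p μ| ≤ π) {j b : Fin d → ℤ}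
    (hj : ∀ μ, 2 * |j μ| < (N : ℤ)) (hb : b ≠ 0) :
    (N : ℝ) ≤ ‖aliasPt p (j + (N : ℤ) • b)‖ := by
  obtain ⟨μ, hμ⟩ : ∃ μ, b μ ≠ 0 := by
    by_contra h
    exact hb (funext fun μ => by simpa using (not_exists.1 h) μ)
  have hN0 : (0 : ℝ) ≤ N := Nat.cast_nonneg N
  have hbμ : (1 : ℝ) ≤ |(b μ : ℝ)| := by
    have : (1 : ℤ) ≤ |b μ| := Int.one_le_abs hμ
    exact_mod_cast this
  have hjμ : |p μ + 2 * π * (j μ : ℝ)| ≤ π * N := by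
    have := zoneA_of_digit hp hj μ; simpa [aliasPt] using this
  have hcoord : (N : ℝ) ≤ |aliasPt p (j + (N : ℤ) • b) μ| := by
    simp only [aliasPt, Pi.add_apply, Pi.smul_apply, smul_eq_mul, Int.cast_add, Int.cast_mul, Int.cast_natCast]
    have hsplit : p μ + 2 * π * ((j μ : ℝ) + (N : ℝ) * (b μ : ℝ))
        = 2 * π * (N : ℝ) * (b μ : ℝ) + (p μ + 2 * π * (j μ : ℝ)) := by ring
    rw [hsplit]
    have hrev : |2 * π * (N : ℝ) * (b μ : ℝ)| - |p μ + 2 * π * (j μ : ℝ)|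
        ≤ |2 * π * (N : ℝ) * (b μ : ℝ) + (p μ + 2 * π * (j μ : ℝ))| := by
      have := abs_sub_abs_le_abs_sub (2 * π * (N : ℝ) * (b μ : ℝ)) (-(p μ + 2 * π * (j μ : ℝ)))
      rwa [abs_neg, sub_neg_eq_add] at this
    have hbig : 2 * π * (N : ℝ) ≤ |2 * π * (N : ℝ) * (b μ : ℝ)| := by
      rw [abs_mul, abs_of_nonneg (by positivity : (0:ℝ) ≤ 2 * π * N)]
      calc 2 * π * (N : ℝ) = 2 * π * (N : ℝ) * 1 := by ring
        _ ≤ 2 * π * (N : ℝ) * |(b μ : ℝ)| := mul_le_mul_of_nonneg_left hbμ (by positivity)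
    have hπN : (N : ℝ) ≤ π * N := by nlinarith [Real.pi_gt_three]
    linarith
  exact hcoord.trans (by rw [← Real.norm_eq_abs]; exact norm_le_pi_norm _ μ)

/-- The combined digit `j + Nb` vanishes only for `j = 0, b = 0` (digits `2|j_μ| < N`). [cite: King1986, (4.19) p.672] -/
theorem combo_ne_zero {d : ℕ} {N : ℕ} {j b : Fin d → ℤ} (hj : ∀ μ, 2 * |j μ| < (N : ℤ)) (hb : b ≠ 0) :
    j + (N : ℤ) • b ≠ 0 := by
  intro h
  have h0 : ∀ μ, 2 * |(0 : Fin d → ℤ) μ| < (N : ℤ) := fun μ => by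
    have := hj μ; simp only [Pi.zero_apply, abs_zero, mul_zero]; linarith [abs_nonneg (j μ)]
  have := digits_injective_pi (M := (N : ℤ)) hj h0 (b := b) (b' := 0) (by simpa using h)
  exact hb this.2

/-- **KING'S PROPOSITION 3.8, MOMENTUM-SPACE CORE (first line of (3.71))**.  Fix the reduced momentum `p′`
(`|p′_μ| ≤ π`), the coarse averaging factor `N` (`= L^k`, spacing `η = N⁻¹`) and the refinement `R` (`= L^n`,
`η′ = (RN)⁻¹`), digit sets `J` (`2|j_μ| < N`: the aliases `l = 2πj` of (4.2)) and `B` (`2|b_μ| < R`: the extra aliases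
`m = 2πNb` of the finer lattice in (4.19)), effective symbols `Δ_A = Δ^{(k)}(p′)`, `Δ_B = Δ^{(k+n)}(p′)` with
`0 ≤ Δ_A ≤ a_A`, `0 ≤ Δ_B ≤ a_B`, Lemma 4.3 in the form `|Δ_B − Δ_A| ≤ θN⁻²Δ_A`, the central domination
`Δ_A ≤ KΔ^η(p′)`, and two positions with `|ξ′_μ − ξ_μ| ≤ δ`.  Then the alias sums of the difference of the mode
families of `a_{k+n}G_{k+n}Q_{k+n}^*` (at `ξ′`) and `a_kG_kQ_k^*` (at `ξ`) obey
`Σ_{j∈J}Σ_{b∈B∖0} ‖T_B(j+Nb)‖ + Σ_{j∈J} ‖T_B(j) − T_A(j)‖ ≤ C₁·N^{−γ} + C₂·δ^γ` (`0 ≤ γ ≤ 1`, `d ≥ 1`),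
uniformly in `p′`, the mass `M ≥ 0` and `R` — King's "|(4.19); m ≠ 0| ≤ CL^{−γk}" plus "every term in (4.19) for
m = 0 can be replaced" with `|x − x′| ≤ L^{−k}`.  Integrating over `p′` ((4.2): on a torus, averaging over the finitely
many reduced momenta) this is the sup-norm two-spacing rate of the minimiser kernel; the exponential factor of (3.71) is
then supplied by "combining our bounds with Theorem 3.3" (p.674), not here. [cite: King1986, Prop. 3.8 (3.71) p.664; (4.19)–(4.31) pp.672–674] -/
theorem alias_sums_two_spacing_le {d : ℕ} (hd : 0 < d) {N R : ℕ} (hN : 1 ≤ N) (hR : 1 ≤ R)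
    {M : ℝ} (hM : 0 ≤ M) {γ : ℝ} (hγ0 : 0 ≤ γ) (hγ1 : γ ≤ 1)
    {ΔA ΔB aA aB θ K : ℝ} (hΔA : 0 ≤ ΔA) (hΔAa : ΔA ≤ aA) (hΔB : 0 ≤ ΔB) (hΔBa : ΔB ≤ aB)
    (hθ : 0 ≤ θ) (hK : 0 ≤ K) (h43 : |ΔB - ΔA| ≤ θ * ((N : ℝ) ^ 2)⁻¹ * ΔA)
    {p : Fin d → ℝ} (hp : ∀ μ, |p μ| ≤ π) (hcen : ΔA ≤ K * latticeSymbol (N : ℝ)⁻¹ M p)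
    {J B : Finset (Fin d → ℤ)} (hJ : ∀ j ∈ J, ∀ μ, 2 * |j μ| < (N : ℤ))
    (hB : ∀ b ∈ B, ∀ μ, 2 * |b μ| < (R : ℤ))
    {ξ ξ' : Fin d → ℝ} {δ : ℝ} (hδ : 0 ≤ δ) (hξ : ∀ μ, |ξ' μ - ξ μ| ≤ δ) :
    (∑ j ∈ J, ∑ b ∈ B.erase 0, ‖modeTerm ΔB ((R : ℝ) * N)⁻¹ M (aliasPt p (j + (N : ℤ) • b)) ξ'‖)
      + ∑ j ∈ J, ‖modeTerm ΔB ((R : ℝ) * N)⁻¹ M (aliasPt p j) ξ' - modeTerm ΔA (N : ℝ)⁻¹ M (aliasPt p j) ξ‖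
      ≤ prop38RateConst aA aB θ K d γ * (N : ℝ) ^ (-γ) + prop38PosConst aA K d γ * δ ^ γ := by
  have hNr : (1 : ℝ) ≤ N := by exact_mod_cast hN
  have hRr : (1 : ℝ) ≤ R := by exact_mod_cast hR
  have hNpos : (0 : ℝ) < N := by linarith
  have hηB : 0 < ((R : ℝ) * N)⁻¹ := by positivity
  have hηBA : ((R : ℝ) * N)⁻¹ ≤ (N : ℝ)⁻¹ := by
    rw [mul_inv]; exact mul_le_of_le_one_left (inv_nonneg.mpr hNpos.le) (inv_le_one_of_one_le₀ hRr)
  have hNγ : 0 ≤ (N : ℝ) ^ (-γ) := Real.rpow_nonneg hNpos.le _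
  have hδγ : 0 ≤ δ ^ γ := Real.rpow_nonneg hδ _
  have haA : 0 ≤ aA := hΔA.trans hΔAa
  have haB : 0 ≤ aB := hΔB.trans hΔBa
  have hAC : 0 ≤ aliasConst d (γ - 1) :=
    (Finset.sum_nonneg fun k _ => aliasTerm_nonneg (γ - 1) p k).trans
      (alias_sum_le_of_subset hd (by linarith) hp (Finset.notMem_empty 0))
  -- FAR PART
  set Λ : Finset (Fin d → ℤ) := (J ×ˢ B.erase 0).image (fun jb => jb.1 + (N : ℤ) • jb.2) with hΛ
  have hinj : Set.InjOn (fun jb : (Fin d → ℤ) × (Fin d → ℤ) => jb.1 + (N : ℤ) • jb.2) ↑(J ×ˢ B.erase 0) := by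
    rintro ⟨j, b⟩ hjb ⟨j', b'⟩ hjb' h
    simp only [Finset.coe_product, Set.mem_prod, Finset.mem_coe] at hjb hjb'
    obtain ⟨h1, h2⟩ := digits_injective_pi (hJ j hjb.1) (hJ j' hjb'.1) h
    exact Prod.ext h1 h2
  have hfar : ∑ j ∈ J, ∑ b ∈ B.erase 0, ‖modeTerm ΔB ((R : ℝ) * N)⁻¹ M (aliasPt p (j + (N : ℤ) • b)) ξ'‖
      ≤ aB * ((π / 2) ^ d * (π ^ 2 / 4)) * (N : ℝ) ^ (-γ) * aliasConst d (γ - 1) := by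
    rw [← Finset.sum_product (s := J) (t := B.erase 0)
      (f := fun jb => ‖modeTerm ΔB ((R : ℝ) * N)⁻¹ M (aliasPt p (jb.1 + (N : ℤ) • jb.2)) ξ'‖)]
    have himg : ∑ jb ∈ J ×ˢ B.erase 0, ‖modeTerm ΔB ((R : ℝ) * N)⁻¹ M (aliasPt p (jb.1 + (N : ℤ) • jb.2)) ξ'‖
        = ∑ k ∈ Λ, ‖modeTerm ΔB ((R : ℝ) * N)⁻¹ M (aliasPt p k) ξ'‖ :=
      (Finset.sum_image (f := fun k => ‖modeTerm ΔB ((R : ℝ) * N)⁻¹ M (aliasPt p k) ξ'‖) hinj).symm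
    rw [himg]
    simp_rw [norm_modeTerm hΔB hM]
    refine sum_modeAmp_far_le hd hηB hM hΔB hΔBa hγ0 (by linarith) hNr hp ?_ ?_ ?_
    · intro h0
      rw [Finset.mem_image] at h0
      obtain ⟨⟨j, b⟩, hjb, hk⟩ := h0
      rw [Finset.mem_product, Finset.mem_erase] at hjb
      exact combo_ne_zero (hJ j hjb.1) hjb.2.1 hk
    · intro k hk μ
      rw [Finset.mem_image] at hk
      obtain ⟨⟨j, b⟩, hjb, rfl⟩ := hk
      rw [Finset.mem_product, Finset.mem_erase] at hjb
      exact zone_of_le (mul_pos (by linarith) hNpos) hηB le_rfl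
        (zoneB_of_digits hp (hJ j hjb.1) (hB b hjb.2.2)) μ
    · intro k hk
      rw [Finset.mem_image] at hk
      obtain ⟨⟨j, b⟩, hjb, rfl⟩ := hk
      rw [Finset.mem_product, Finset.mem_erase] at hjb
      exact far_of_digits hp (hJ j hjb.1) hjb.2.1
  -- NEAR PART (j ≠ 0) and CENTRAL PART
  set g : (Fin d → ℤ) → ℝ := fun j =>
    ‖modeTerm ΔB ((R : ℝ) * N)⁻¹ M (aliasPt p j) ξ' - modeTerm ΔA (N : ℝ)⁻¹ M (aliasPt p j) ξ‖ with hg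
  have hg0 : ∀ j, 0 ≤ g j := fun j => norm_nonneg _
  have hnear : ∑ j ∈ J.erase 0, g j
      ≤ (nearRateConst aA θ d γ * (N : ℝ) ^ (-γ) + nearPosConst aA d γ * δ ^ γ) * aliasConst d (γ - 1) := by
    calc ∑ j ∈ J.erase 0, g j
        ≤ ∑ j ∈ J.erase 0, (nearRateConst aA θ d γ * (N : ℝ) ^ (-γ) + nearPosConst aA d γ * δ ^ γ)
            * aliasTerm (γ - 1) p j := by
          refine Finset.sum_le_sum fun j hj => ?_
          rw [Finset.mem_erase] at hj
          exact norm_modeTerm_sub_near_le hNr hηB hηBA hM hγ0 hγ1 hΔA hΔAa hθ h43 hp hj.1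
            (zoneA_of_digit hp (hJ j hj.2)) hδ hξ
      _ = (nearRateConst aA θ d γ * (N : ℝ) ^ (-γ) + nearPosConst aA d γ * δ ^ γ)
            * ∑ j ∈ J.erase 0, aliasTerm (γ - 1) p j := by rw [Finset.mul_sum]
      _ ≤ _ := by
          refine mul_le_mul_of_nonneg_left
            (alias_sum_le_of_subset hd (by linarith) hp (Finset.notMem_erase 0 J)) ?_
          have h1 : 0 ≤ nearRateConst aA θ d γ := by unfold nearRateConst; positivity
          have h2 : 0 ≤ nearPosConst aA d γ := by unfold nearPosConst; positivity
          positivity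
  have hcentral : g 0 ≤ centralRateConst aA θ K d γ * (N : ℝ) ^ (-γ) + centralPosConst K d γ * δ ^ γ := by
    simp only [hg, aliasPt_zero]
    exact norm_modeTerm_sub_central_le hNr hηB hηBA hM hγ0 hγ1 hΔA hΔAa hθ hK h43 hp hcen hδ hξ
  have hsplit : ∑ j ∈ J, g j ≤ g 0 + ∑ j ∈ J.erase 0, g j := by
    by_cases h0 : (0 : Fin d → ℤ) ∈ J
    · rw [Finset.add_sum_erase J g h0]
    · rw [Finset.erase_eq_of_notMem h0]; linarith [hg0 0]
  have hc1 : 0 ≤ centralRateConst aA θ K d γ := by unfold centralRateConst; positivity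
  have hc2 : 0 ≤ centralPosConst K d γ := by unfold centralPosConst; positivity
  -- ASSEMBLY
  calc (∑ j ∈ J, ∑ b ∈ B.erase 0, ‖modeTerm ΔB ((R : ℝ) * N)⁻¹ M (aliasPt p (j + (N : ℤ) • b)) ξ'‖)
        + ∑ j ∈ J, g j
      ≤ aB * ((π / 2) ^ d * (π ^ 2 / 4)) * (N : ℝ) ^ (-γ) * aliasConst d (γ - 1)
        + ((centralRateConst aA θ K d γ * (N : ℝ) ^ (-γ) + centralPosConst K d γ * δ ^ γ)
          + (nearRateConst aA θ d γ * (N : ℝ) ^ (-γ) + nearPosConst aA d γ * δ ^ γ) * aliasConst d (γ - 1)) :=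
        add_le_add hfar (hsplit.trans (add_le_add hcentral hnear))
    _ = prop38RateConst aA aB θ K d γ * (N : ℝ) ^ (-γ) + prop38PosConst aA K d γ * δ ^ γ := by
        simp only [prop38RateConst, prop38PosConst]; ring

/-! ## §5 King's own symbols satisfy the hypotheses: `Δ^{(k)} = DeltaEff (a_k) (L^k)`, Lemma 4.3, (4.21) at `l = 0` -/

section KingSymbols

open Literature.MathematicalPhysics.QuantumFieldTheory.Balaban1983to89

variable {dd : ℕ}

/-- `Δ^{(k)}(p′) ≥ 0` (`a ≥ 0`, `m² ≥ 0`): the alias sum of (4.5) has nonnegative terms. [cite: King1986, (4.5) p.670] -/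
theorem DeltaEff_nonneg {a : ℝ} (ha : 0 ≤ a) (N : ℕ) {M : ℝ} (hM : 0 ≤ M) (p : Fin dd → ℝ) :
    0 ≤ DeltaEff a N M p := by
  unfold DeltaEff composedInvResc
  refine inv_nonneg.mpr (add_nonneg (inv_nonneg.mpr ha) (Finset.sum_nonneg fun m _ => ?_))
  exact mul_nonneg (B4Strip.Ur_nonneg N m p) (inv_nonneg.mpr (B4Strip.DeltaXir_nonneg N M hM _))

/-- **(4.21) at the central alias**: `Δ^{(k)}(p′) ≤ (π²/4)^d·Δ^η(p′)` whenever `Δ^η(p′) > 0` (e.g. `m² > 0`): keep only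
the `l = 0` term of (4.5), `Δ^{(k)} ≤ (|u(p′)|²Δ^η(p′)⁻¹)⁻¹`, and `|u_k^η(p′)|² ≥ (4/π²)^d` on the zone (Jordan).
[cite: King1986, (4.5) p.670, (4.21) p.672] -/
theorem DeltaEff_le_mul_latticeSymbol {a : ℝ} (ha : 0 < a) {N : ℕ} [NeZero N] (hN : 1 ≤ N) {M : ℝ} (hM : 0 ≤ M)
    {p : Fin dd → ℝ} (hp : ∀ μ, |p μ| ≤ π) (hls : 0 < latticeSymbol (N : ℝ)⁻¹ M p) :
    DeltaEff a N M p ≤ (π ^ 2 / 4) ^ dd * latticeSymbol (N : ℝ)⁻¹ M p := by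
  have hN0 : N ≠ 0 := by omega
  set ls := latticeSymbol (N : ℝ)⁻¹ M p with hls_def
  -- the `l = 0` term of the alias sum
  have hterm : (4 / π ^ 2) ^ dd * ls⁻¹
      ≤ B4Strip.Ur N (fun _ => (0 : Fin N)) p
        * (B4Strip.DeltaXir N M (B4Strip.shiftr N (fun _ => (0 : Fin N)) p))⁻¹ := by
    rw [shiftr_zero, DeltaXir_eq_latticeSymbol hN0]
    exact mul_le_mul_of_nonneg_right (B4Strip.Ur_zero_ge N hN p hp) (inv_nonneg.mpr hls.le)
  have hsum : (4 / π ^ 2) ^ dd * ls⁻¹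
      ≤ a⁻¹ + ∑ m : Fin dd → Fin N, B4Strip.Ur N m p * (B4Strip.DeltaXir N M (B4Strip.shiftr N m p))⁻¹ := by
    refine hterm.trans ((Finset.single_le_sum (f := fun m : Fin dd → Fin N =>
      B4Strip.Ur N m p * (B4Strip.DeltaXir N M (B4Strip.shiftr N m p))⁻¹) (fun m _ => ?_)
      (Finset.mem_univ (fun _ => (0 : Fin N)))).trans ?_)
    · exact mul_nonneg (B4Strip.Ur_nonneg N m p) (inv_nonneg.mpr (B4Strip.DeltaXir_nonneg N M hM _))
    · linarith [inv_pos.mpr ha]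
  have hpos : 0 < (4 / π ^ 2) ^ dd * ls⁻¹ := by positivity
  unfold DeltaEff composedInvResc
  calc (a⁻¹ + ∑ m : Fin dd → Fin N, B4Strip.Ur N m p * (B4Strip.DeltaXir N M (B4Strip.shiftr N m p))⁻¹)⁻¹
      ≤ ((4 / π ^ 2) ^ dd * ls⁻¹)⁻¹ := inv_anti₀ hpos hsum
    _ = (π ^ 2 / 4) ^ dd * ls := by
        rw [mul_inv, inv_inv, ← inv_pow, inv_div]

/-- The same with the convenient hypothesis `m² > 0` (then `Δ^η(p′) ≥ m² > 0`). [cite: King1986, (4.21) p.672] -/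
theorem DeltaEff_le_mul_latticeSymbol_of_mass {a : ℝ} (ha : 0 < a) {N : ℕ} [NeZero N] (hN : 1 ≤ N) {M : ℝ}
    (hM : 0 < M) {p : Fin dd → ℝ} (hp : ∀ μ, |p μ| ≤ π) :
    DeltaEff a N M p ≤ (π ^ 2 / 4) ^ dd * latticeSymbol (N : ℝ)⁻¹ M p :=
  DeltaEff_le_mul_latticeSymbol ha hN hM.le hp (lt_of_lt_of_le hM (by
    have hs : 0 ≤ ∑ μ, fdSymbol (N : ℝ)⁻¹ (p μ) := Finset.sum_nonneg fun μ _ => fdSymbol_nonneg _ (p μ)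
    unfold latticeSymbol; linarith))

/-- **Lemma 4.3 at the zero mode, relative form**: `|Δ^{(k+n)}(0) − Δ^{(k)}(0)| ≤ θL^{−2k}Δ^{(k)}(0)` — the two
symbols are `(a_k⁻¹ + m⁻²)⁻¹`, `(a_{k+n}⁻¹ + m⁻²)⁻¹` with `a_{k+n}⁻¹ = a_k⁻¹ + L^{−2k}a_n⁻¹` ((2.13), `inv_aK_add`).
[cite: King1986, Lemma 4.3 (4.18) p.672, (2.13) p.653] -/
theorem lemma43_aK_rel_zero {a : ℝ} (ha : 0 < a) {L k n : ℕ} (hL : 2 ≤ L) (hk : 1 ≤ k) (hn : 1 ≤ n)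
    {M : ℝ} (hM : 0 ≤ M) :
    |DeltaEff (aK a L (k + n)) (L ^ n * L ^ k) M (0 : Fin dd → ℝ) - DeltaEff (aK a L k) (L ^ k) M (0 : Fin dd → ℝ)|
      ≤ lemma43Const a L k n * (((L ^ k : ℕ) : ℝ) ^ 2)⁻¹ * DeltaEff (aK a L k) (L ^ k) M (0 : Fin dd → ℝ) := by
  have hL0 : L ≠ 0 := by omega
  haveI : NeZero (L ^ k) := ⟨pow_ne_zero _ hL0⟩
  haveI : NeZero (L ^ n * L ^ k) := ⟨mul_ne_zero (pow_ne_zero _ hL0) (pow_ne_zero _ hL0)⟩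
  have hLr : (1 : ℝ) < L := by exact_mod_cast (lt_of_lt_of_le one_lt_two hL)
  have hLr2 : (2 : ℝ) ≤ L := by exact_mod_cast hL
  rw [Torus.DeltaEff_zero, Torus.DeltaEff_zero]
  have hak : 0 < aK a L k := aK_pos ha hLr hk
  have han : 0 < aK a L n := aK_pos ha hLr hn
  have hakn : 0 < aK a L (k + n) := aK_pos ha hLr (by omega)
  set x := (aK a (L : ℝ) k)⁻¹ + M⁻¹ with hx
  set c := ((L : ℝ) ^ (2 * k))⁻¹ * (aK a (L : ℝ) n)⁻¹ with hc
  have hc0 : 0 ≤ c := by positivity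
  have hx0 : 0 < x := by positivity
  have hy : (aK a (L : ℝ) (k + n))⁻¹ + M⁻¹ = x + c := by rw [inv_aK_add ha hLr k n]; ring
  rw [hy]
  have hy0 : 0 < x + c := by positivity
  -- `|1/(x+c) − 1/x| = c/(x(x+c)) ≤ c·a_{k+n}/x`
  have hdiff : |(x + c)⁻¹ - x⁻¹| = c * ((x + c)⁻¹ * x⁻¹) := by
    rw [abs_sub_comm, inv_sub_inv (ne_of_gt hx0) (ne_of_gt hy0), add_sub_cancel_left,
      abs_of_nonneg (by positivity)]
    field_simp
  have hyinv : (x + c)⁻¹ ≤ aK a (L : ℝ) (k + n) := by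
    rw [← hy]
    calc ((aK a (L : ℝ) (k + n))⁻¹ + M⁻¹)⁻¹ ≤ ((aK a (L : ℝ) (k + n))⁻¹)⁻¹ :=
          inv_anti₀ (by positivity) (le_add_of_nonneg_right (inv_nonneg.mpr hM))
      _ = aK a (L : ℝ) (k + n) := inv_inv _
  have hakn_le : aK a (L : ℝ) (k + n) ≤ a := aK_le ha hLr (by omega)
  have hak_ge : a * (1 - ((L : ℝ) ^ 2)⁻¹) ≤ aK a (L : ℝ) k := aK_ge ha hLr hk
  have hL2 : (3 : ℝ) / 4 ≤ 1 - ((L : ℝ) ^ 2)⁻¹ := by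
    have : ((L : ℝ) ^ 2)⁻¹ ≤ 1 / 4 := by
      rw [inv_le_comm₀ (by positivity) (by norm_num)]; nlinarith
    linarith
  have hpow : ((L : ℝ) ^ (2 * k))⁻¹ = ((((L ^ k : ℕ) : ℝ)) ^ 2)⁻¹ := by
    push_cast; rw [← pow_mul, mul_comm]
  rw [hdiff]
  calc c * ((x + c)⁻¹ * x⁻¹) ≤ c * (aK a (L : ℝ) (k + n) * x⁻¹) := by gcongr
    _ ≤ c * (a * x⁻¹) := by gcongr
    _ = ((((L ^ k : ℕ) : ℝ)) ^ 2)⁻¹ * ((aK a (L : ℝ) n)⁻¹ * a) * x⁻¹ := by rw [hc, hpow]; ring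
    _ ≤ ((((L ^ k : ℕ) : ℝ)) ^ 2)⁻¹ * lemma43Const a L k n * x⁻¹ := by
        refine mul_le_mul_of_nonneg_right (mul_le_mul_of_nonneg_left ?_ (by positivity)) (by positivity)
        unfold lemma43Const
        have h34 : a ≤ 2 * aK a (L : ℝ) k := by nlinarith
        have : (aK a (L : ℝ) n)⁻¹ * a ≤ (aK a (L : ℝ) n)⁻¹ * (2 * aK a (L : ℝ) k) :=
          mul_le_mul_of_nonneg_left h34 (by positivity)
        nlinarith [inv_pos.mpr han, Real.pi_pos, hak]
    _ = lemma43Const a L k n * (((L ^ k : ℕ) : ℝ) ^ 2)⁻¹ * x⁻¹ := by ring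

/-- **Lemma 4.3 in the relative form used by §4–§6, at EVERY reduced momentum** (`|p′_μ| ≤ π`, incl. `p′ = 0`), for
King's symbols `Δ_A = Δ^{(k)} = DeltaEff a_k L^k`, `Δ_B = Δ^{(k+n)} = DeltaEff a_{k+n} (L^n·L^k)`:
`|Δ_B − Δ_A| ≤ θ·(L^k)^{−2}·Δ_A`. [cite: King1986, Lemma 4.3 (4.18) p.672] -/
theorem lemma43_aK_rel {a : ℝ} (ha : 0 < a) {L k n : ℕ} (hL : 2 ≤ L) (hk : 1 ≤ k) (hn : 1 ≤ n)
    {M : ℝ} (hM : 0 ≤ M) {p : Fin dd → ℝ} (hp : ∀ μ, |p μ| ≤ π) :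
    |DeltaEff (aK a L (k + n)) (L ^ n * L ^ k) M p - DeltaEff (aK a L k) (L ^ k) M p|
      ≤ lemma43Const a L k n * (((L ^ k : ℕ) : ℝ) ^ 2)⁻¹ * DeltaEff (aK a L k) (L ^ k) M p := by
  rcases (momSq_nonneg p).eq_or_lt with h0 | hpos
  · have hq : p = 0 := funext fun μ => by
      have h := (Finset.sum_eq_zero_iff_of_nonneg (fun ν _ => sq_nonneg (p ν))).mp h0.symm μ (Finset.mem_univ μ)
      exact pow_eq_zero_iff (n := 2) (by norm_num) |>.mp h
    subst hq
    exact lemma43_aK_rel_zero ha hL hk hn hM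
  · have h := lemma43_aK ha hL hk hn hM hp hpos
    rw [abs_sub_comm]
    refine h.trans (le_of_eq ?_)
    unfold lemma43Const; ring

/-- **PROPOSITION 3.8, MOMENTUM-SPACE CORE, FOR KING'S SYMBOLS.**  With `Δ_A = Δ^{(k)}(p′)` and `Δ_B = Δ^{(k+n)}(p′)`
the effective Laplacians (4.5) of the `L^k`- and `L^{k+n}`-block transformations with King's constants `a_k`,
`a_{k+n}` ((2.13)), mass `m² > 0`, `L ≥ 2`, `k, n ≥ 1`: the alias sums of the two-spacing difference of the mode families
of `a_{k+n}G_{k+n}Q_{k+n}^*` at `x′` and `a_kG_kQ_k^*` at `x` ((4.2)/(4.19); digits `2|j_μ| < L^k`, `2|b_μ| < L^n`,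
`|x′_μ − x_μ| ≤ δ`) are `≤ C₁·L^{−γk} + C₂·δ^γ`, uniformly in `p′ ∈ [−π,π]^d`, the mass and `n`, for every
`0 ≤ γ ≤ 1`; at `δ = L^{−k}` this is King's `CL^{−γk}`.  Constants: `C₁ = prop38RateConst a a θ (π²/4)^d d γ`,
`C₂ = prop38PosConst a (π²/4)^d d γ`, `θ = lemma43Const a L k n`. [cite: King1986, Prop. 3.8 (3.71) p.664; (4.19)–(4.31) pp.672–674] -/
theorem king_prop38_aliasSums {d : ℕ} (hd : 0 < d) {a : ℝ} (ha : 0 < a) {L k n : ℕ} (hL : 2 ≤ L)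
    (hk : 1 ≤ k) (hn : 1 ≤ n) {M : ℝ} (hM : 0 < M) {γ : ℝ} (hγ0 : 0 ≤ γ) (hγ1 : γ ≤ 1)
    {p : Fin d → ℝ} (hp : ∀ μ, |p μ| ≤ π)
    {J B : Finset (Fin d → ℤ)} (hJ : ∀ j ∈ J, ∀ μ, 2 * |j μ| < ((L ^ k : ℕ) : ℤ))
    (hB : ∀ b ∈ B, ∀ μ, 2 * |b μ| < ((L ^ n : ℕ) : ℤ))
    {ξ ξ' : Fin d → ℝ} {δ : ℝ} (hδ : 0 ≤ δ) (hξ : ∀ μ, |ξ' μ - ξ μ| ≤ δ) :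
    (∑ j ∈ J, ∑ b ∈ B.erase 0,
        ‖modeTerm (DeltaEff (aK a L (k + n)) (L ^ n * L ^ k) M p) (((L ^ n : ℕ) : ℝ) * ((L ^ k : ℕ) : ℝ))⁻¹ M
          (aliasPt p (j + ((L ^ k : ℕ) : ℤ) • b)) ξ'‖)
      + ∑ j ∈ J, ‖modeTerm (DeltaEff (aK a L (k + n)) (L ^ n * L ^ k) M p) (((L ^ n : ℕ) : ℝ) * ((L ^ k : ℕ) : ℝ))⁻¹
            M (aliasPt p j) ξ'
          - modeTerm (DeltaEff (aK a L k) (L ^ k) M p) (((L ^ k : ℕ) : ℝ))⁻¹ M (aliasPt p j) ξ‖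
      ≤ prop38RateConst a a (lemma43Const a L k n) ((π ^ 2 / 4) ^ d) d γ * ((L ^ k : ℕ) : ℝ) ^ (-γ)
        + prop38PosConst a ((π ^ 2 / 4) ^ d) d γ * δ ^ γ := by
  have hL0 : L ≠ 0 := by omega
  haveI : NeZero (L ^ k) := ⟨pow_ne_zero _ hL0⟩
  have hLr : (1 : ℝ) < L := by exact_mod_cast (lt_of_lt_of_le one_lt_two hL)
  have hNk : 1 ≤ L ^ k := Nat.one_le_pow _ _ (by omega)
  have hNn : 1 ≤ L ^ n := Nat.one_le_pow _ _ (by omega)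
  have hΔA0 : 0 ≤ DeltaEff (aK a L k) (L ^ k) M p := DeltaEff_nonneg (aK_pos ha hLr hk).le _ hM.le p
  have hΔAa : DeltaEff (aK a L k) (L ^ k) M p ≤ a :=
    (DeltaEff_le (aK_pos ha hLr hk) _ hM.le p).trans (aK_le ha hLr hk)
  have hΔB0 : 0 ≤ DeltaEff (aK a L (k + n)) (L ^ n * L ^ k) M p :=
    DeltaEff_nonneg (aK_pos ha hLr (by omega)).le _ hM.le p
  have hΔBa : DeltaEff (aK a L (k + n)) (L ^ n * L ^ k) M p ≤ a :=
    (DeltaEff_le (aK_pos ha hLr (by omega)) _ hM.le p).trans (aK_le ha hLr (by omega))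
  have h43 := lemma43_aK_rel ha hL hk hn hM.le hp
  have hcen := DeltaEff_le_mul_latticeSymbol_of_mass (aK_pos ha hLr hk) hNk hM hp
  exact alias_sums_two_spacing_le hd hNk hNn hM.le hγ0 hγ1 hΔA0 hΔAa hΔB0 hΔBa
    (lemma43Const_nonneg ha hL hk hn) (by positivity) h43 hp hcen hJ hB hδ hξ

end KingSymbols

end Literature.MathematicalPhysics.QuantumFieldTheory.King1986
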